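import Mathlib.Algebra.Homology.HomologySequenceLemmas
import HarnessLib

/-!
# The homology sequence: two-out-of-three for the first term

Mathlib (`Mathlib/Algebra/Homology/HomologySequenceLemmas.lean`, J. Riou) proves, for a morphism
`φ : S₁ ⟶ S₂` between short exact sequences of homological complexes in an abelian category,
that `φ.τ₃` is a quasi-isomorphism when `φ.τ₁` and `φ.τ₂` are (`quasiIso_τ₃`), and leaves the
analogous statements for `φ.τ₁` and `φ.τ₂` as a TODO. This file supplies the `τ₁` case, which is
the shape of every **Mayer–Vietoris ladder** argument for *cohomology* theories of open subsets
(`0 → F(U ∪ V) → F(U) ⊞ F(V) → F(U ∩ V) → 0`: the union is the *first* term): Bredon,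
*Topology and Geometry* (1993), Lemma V.9.4 / proof of Thm. V.9.5 (de Rham's theorem);
Hatcher (2002), p. 247 (Poincaré duality, Step (A)), both "by the five-lemma".

* `mono_homologyMap_τ₁`, `epi_homologyMap_τ₁`, `isIso_homologyMap_τ₁`: degreewise criteria
  (the four lemmas applied to the six-term exact sequences
  `Hᵢ X₁ → Hᵢ X₂ → Hᵢ X₃ → Hⱼ X₁ → Hⱼ X₂ → Hⱼ X₃` of Mathlib's `composableArrows₅`, and, in a
  degree `j` without predecessor, to `0 → Hⱼ X₁ → Hⱼ X₂ → Hⱼ X₃`);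
* `quasiIso_τ₁`: `φ.τ₂`, `φ.τ₃` quasi-isomorphisms ⇒ `φ.τ₁` quasi-isomorphism;
* `isIso_homologyMap_τ₁_of_forall`: the all-degrees form with `IsIso` hypotheses, the form used
  by the Mayer–Vietoris ladders of the de Rham theorem files.

## References

* G. E. Bredon, *Topology and Geometry*, GTM 139 (1993), Lemma V.9.4.
* A. Hatcher, *Algebraic Topology* (2002), §2.1 (five-lemma), p. 247.
-/

open CategoryTheory ComposableArrows Abelian

namespace Literature.Algebra.Homology

variable {C ι : Type*} [Category C] [Abelian C] {c : ComplexShape ι}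
  {S₁ S₂ : ShortComplex (HomologicalComplex C c)} (φ : S₁ ⟶ S₂)
  (hS₁ : S₁.ShortExact) (hS₂ : S₂.ShortExact)

open HomologicalComplex HomologicalComplex.HomologySequence

include hS₁ hS₂

/-- **Four lemma for `τ₁`, mono version.** If `Hⱼ(φ.τ₂)` is a monomorphism and, for the
predecessor `i` of `j` (if any), `Hᵢ(φ.τ₂)` is an epimorphism and `Hᵢ(φ.τ₃)` a monomorphism, then
`Hⱼ(φ.τ₁)` is a monomorphism (Bredon (1993), Lemma V.9.4, via the four lemma on
`Hᵢ X₂ → Hᵢ X₃ → Hⱼ X₁ → Hⱼ X₂`). [cite: Bredon1993, Lemma V.9.4] -/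
theorem mono_homologyMap_τ₁ (j : ι)
    (h₁ : Mono (homologyMap φ.τ₂ j))
    (h₂ : ∀ i, c.Rel i j → Epi (homologyMap φ.τ₂ i))
    (h₃ : ∀ i, c.Rel i j → Mono (homologyMap φ.τ₃ i)) :
    Mono (homologyMap φ.τ₁ j) := by
  by_cases hj : ∃ i, c.Rel i j
  · obtain ⟨i, hij⟩ := hj
    apply mono_of_epi_of_mono_of_mono
      ((δ₀Functor ⋙ δlastFunctor).map (mapComposableArrows₅ φ hS₁ hS₂ i j hij))
    · exact (composableArrows₅_exact hS₁ i j hij).δ₀.δlast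
    · exact (composableArrows₅_exact hS₂ i j hij).δ₀.δlast
    · exact h₂ i hij
    · exact h₃ i hij
    · exact h₁
  · have := hS₁.mono_f
    have : Mono (homologyMap S₁.f j) :=
      mono_homologyMap_of_mono_of_not_rel S₁.f j (by simpa using hj)
    have eq : homologyMap φ.τ₁ j ≫ homologyMap S₂.f j = homologyMap S₁.f j ≫ homologyMap φ.τ₂ j := by
      rw [← homologyMap_comp, ← homologyMap_comp, φ.comm₁₂]
    haveI : Mono (homologyMap φ.τ₁ j ≫ homologyMap S₂.f j) := by
      rw [eq]
      exact mono_comp _ _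
    exact mono_of_mono (homologyMap φ.τ₁ j) (homologyMap S₂.f j)

/-- **Four lemma for `τ₁`, epi version.** If `Hⱼ(φ.τ₂)` is an epimorphism, `Hⱼ(φ.τ₃)` a
monomorphism and, for the predecessor `i` of `j` (if any), `Hᵢ(φ.τ₃)` is an epimorphism, then
`Hⱼ(φ.τ₁)` is an epimorphism (four lemma on `Hᵢ X₃ → Hⱼ X₁ → Hⱼ X₂ → Hⱼ X₃`; in a degree without
predecessor, on `0 → Hⱼ X₁ → Hⱼ X₂ → Hⱼ X₃`). [cite: Bredon1993, Lemma V.9.4] -/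
theorem epi_homologyMap_τ₁ (j : ι)
    (h₁ : Epi (homologyMap φ.τ₂ j))
    (h₂ : Mono (homologyMap φ.τ₃ j))
    (h₃ : ∀ i, c.Rel i j → Epi (homologyMap φ.τ₃ i)) :
    Epi (homologyMap φ.τ₁ j) := by
  by_cases hj : ∃ i, c.Rel i j
  · obtain ⟨i, hij⟩ := hj
    apply epi_of_epi_of_epi_of_mono
      ((δ₀Functor ⋙ δ₀Functor).map (mapComposableArrows₅ φ hS₁ hS₂ i j hij))
    · exact (composableArrows₅_exact hS₁ i j hij).δ₀.δ₀
    · exact (composableArrows₅_exact hS₂ i j hij).δ₀.δ₀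
    · exact h₃ i hij
    · exact h₁
    · exact h₂
  · have := hS₂.mono_f
    have : Mono (homologyMap S₂.f j) :=
      mono_homologyMap_of_mono_of_not_rel S₂.f j (by simpa using hj)
    exact CategoryTheory.ShortComplex.epi_of_mono_of_epi_of_mono
      ((homologyFunctor C c j).mapShortComplex.map φ) (hS₁.homology_exact₂ j) this h₁ h₂

/-- **Five lemma for `τ₁` in one degree**: `Hⱼ(φ.τ₁)` is an isomorphism as soon as `Hⱼ(φ.τ₂)`
is an isomorphism, `Hⱼ(φ.τ₃)` a monomorphism, and in the preceding degree `Hᵢ(φ.τ₂)` is an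
epimorphism and `Hᵢ(φ.τ₃)` an isomorphism (Bredon (1993), Lemma V.9.4; Hatcher (2002), p. 247).
[cite: Bredon1993, Lemma V.9.4] -/
theorem isIso_homologyMap_τ₁ (j : ι)
    (h₁ : IsIso (homologyMap φ.τ₂ j))
    (h₂ : Mono (homologyMap φ.τ₃ j))
    (h₃ : ∀ i, c.Rel i j → Epi (homologyMap φ.τ₂ i))
    (h₄ : ∀ i, c.Rel i j → IsIso (homologyMap φ.τ₃ i)) :
    IsIso (homologyMap φ.τ₁ j) := by
  have := mono_homologyMap_τ₁ φ hS₁ hS₂ j inferInstance h₃ (fun i hij => by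
    have := h₄ i hij
    infer_instance)
  have := epi_homologyMap_τ₁ φ hS₁ hS₂ j inferInstance h₂ (fun i hij => by
    have := h₄ i hij
    infer_instance)
  apply isIso_of_mono_of_epi

/-- **Two-out-of-three for `τ₁`**: if `φ.τ₂` and `φ.τ₃` are quasi-isomorphisms, so is `φ.τ₁`
(the case left as TODO in Mathlib's `HomologySequenceLemmas`; Bredon (1993), Lemma V.9.4).
[cite: Bredon1993, Lemma V.9.4] -/
theorem quasiIso_τ₁ (h₂ : QuasiIso φ.τ₂) (h₃ : QuasiIso φ.τ₃) : QuasiIso φ.τ₁ := by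
  rw [quasiIso_iff]
  intro j
  rw [quasiIsoAt_iff_isIso_homologyMap]
  apply isIso_homologyMap_τ₁ φ hS₁ hS₂
  all_goals intros; infer_instance

/-- **Mayer–Vietoris ladder step** (all-degrees `IsIso` form): if `H•(φ.τ₂)` and `H•(φ.τ₃)` are
isomorphisms in every degree, so is `H•(φ.τ₁)` (Bredon (1993), Lemma V.9.4: "if the theorem holds
for `U`, `V` and `U ∩ V` then it holds for `U ∪ V`"). [cite: Bredon1993, Lemma V.9.4] -/
theorem isIso_homologyMap_τ₁_of_forall (h₂ : ∀ j, IsIso (homologyMap φ.τ₂ j))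
    (h₃ : ∀ j, IsIso (homologyMap φ.τ₃ j)) (j : ι) : IsIso (homologyMap φ.τ₁ j) := by
  apply isIso_homologyMap_τ₁ φ hS₁ hS₂ j (h₂ j)
  · haveI := h₃ j; infer_instance
  · intro i _; haveI := h₂ i; infer_instance
  · exact fun i _ => h₃ i

end Literature.Algebra.Homology
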